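import Literature.MathematicalPhysics.QuantumLattice.HubbardLangerMattisTorus
import HarnessLib

/-!
# Ventures/CertifiedManyBodySolver — Lower/PauliDoublonBlock.lean: the `2 × 2` block floor of the Pauli–doublon bound (LEMMA B, proved)

HONEST FRAMING: first certified bounds; not a superconductivity verdict; every number certified or labelled float.

Part 1/4 of the Pauli–doublon (doped Langer–Mattis) floor; statement, chain and print placement in
`Lower/PauliDoublonFloor.lean`. Here: the closed form `blockFloor` `s̃(ε; U, κ, α, ν)` = the sum of the negative parts
of the two eigenvalues of `K^{1/2} [[ε+α, ε+ν],[ε+ν, ε+α+U/2]] K^{1/2}`, `K = diag(1−κ, κ)`; the Brillouin-zone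
integrand `pdbIntegrand` (continuity, `(π, π)`-shift); the corner Riemann-sum dictionary `sum_cellCorner_div_eq`; and
LEMMA B `rankTwoFloorQF_holds`: for `0 ⪯ G ⪯ K` (as real binary forms) `tr(C G) ≥ −s̃` — elementary real algebra
(the two spectral projections of the block pulled back to `G`-space are PSD with vanishing determinant; their pairings
with `G` and `K − G` are nonnegative, so `tr(CG) = λ₊t₊ + λ₋t₋` with `t± ∈ [0, 1]`), the `2 × 2` case of the
one-body trace floor `Re Tr(Nρ) ≥ −Tr N⁻` for `0 ⪯ ρ ⪯ 1` [cite: LiebLoss1993, §8, proof of Theorem 8.2].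
Mathematics and Lean proofs: hubbard-alg L3 seat B (planner-sr-mbsolver-l3-idea-2 g25/g26, `HOME/hubbard-alg/L3-hybrid/tools-seatB/pdbl/NOTE-PDB-L.md` §6, `PauliDoublonSketch.lean` v6 sha16 54e19fa031dc4b1e); tree placement and citations: LIT lane (literature-prover lit-1 g22). Three definitions, everything else proved; 0 sorry.
-/

noncomputable section

namespace Summit.Ventures.CertifiedManyBodySolver.Lower

namespace PauliDoublon

open Literature.MathematicalPhysics.QuantumLattice
open Matrix Finset Filter Literature.Probability.LatticeModels ThermodynamicLimit LangerMattis MeasureTheory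
open scoped Topology ComplexOrder


/-- The 2×2 block floor `s̃(ε; κ, α, ν, U)` = sum of the NEGATIVE parts of the two eigenvalues of
`N = K^{1/2} C K^{1/2}`, `K = diag(1-κ, κ)`, `C = [[ε+α, ε+ν],[ε+ν, ε+α+U/2]]` (closed form). [folklore] -/
def blockFloor (ε U κ α ν : ℝ) : ℝ :=
  let n₁₁ := (1 - κ) * (ε + α)
  let n₂₂ := κ * (ε + α + U / 2)
  let n₁₂sq := (1 - κ) * κ * (ε + ν) ^ 2
  let half := (n₁₁ + n₂₂) / 2
  let disc := Real.sqrt ((n₁₁ - n₂₂) ^ 2 / 4 + n₁₂sq)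
  max (-(half + disc)) 0 + max (-(half - disc)) 0

/-- The PDB integrand on the Brillouin zone: `s̃(ε(p); κ, α, ν, U)` with the torus band
`ε(p) = -t · 2 Σ_i cos p_i` (sign of `lmOneBody = -t A_G + (U/2) 1_w`). [folklore] -/
def pdbIntegrand {d : ℕ} (t U κ α ν : ℝ) (p : Fin d → ℝ) : ℝ :=
  blockFloor (-(t * (2 * ∑ i, Real.cos (p i)))) U κ α ν

/-- The shift `p ↦ p + (π,…,π)` flips the sign of `t` in the PDB integrand. [folklore] -/
theorem pdbIntegrand_add_pi {d : ℕ} (t U κ α ν : ℝ) (p : Fin d → ℝ) :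
    pdbIntegrand t U κ α ν (p + fun _ => Real.pi) = pdbIntegrand (-t) U κ α ν p := by
  simp only [pdbIntegrand, Pi.add_apply, Real.cos_add_pi, Finset.sum_neg_distrib, mul_neg, neg_mul,
    neg_neg]

/-- The block floor is continuous in the band energy. [folklore] -/
theorem continuous_blockFloor (U κ α ν : ℝ) : Continuous fun ε : ℝ => blockFloor ε U κ α ν := by
  unfold blockFloor
  dsimp only
  fun_prop

/-- The PDB integrand is continuous on momentum space. [folklore] -/
theorem continuous_pdbIntegrand {d : ℕ} (t U κ α ν : ℝ) :
    Continuous (pdbIntegrand (d := d) t U κ α ν) := by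
  have hs : Continuous fun p : Fin d → ℝ => ∑ i, Real.cos (p i) :=
    continuous_finsetSum _ fun i _ => Real.continuous_cos.comp (continuous_apply i)
  unfold pdbIntegrand
  exact (continuous_blockFloor U κ α ν).comp ((continuous_const.mul (continuous_const.mul hs)).neg)

/-- Corner sums are corner Riemann sums: `L^{-d} Σ_k G(c_k) = (2π)^{-d} · cornerRiemannSum G L`. [folklore] -/
theorem sum_cellCorner_div_eq {d L : ℕ} [NeZero L] (G : (Fin d → ℝ) → ℝ) :
    (∑ k : TorusSite d L, G (cellCorner k)) / (L : ℝ) ^ d =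
      ((2 * Real.pi) ^ d)⁻¹ * cornerRiemannSum G L := by
  have hL : (L : ℝ) ≠ 0 := by exact_mod_cast NeZero.ne L
  have hπ : (2 * Real.pi : ℝ) ≠ 0 := by positivity
  rw [cornerRiemannSum_eq, ← Finset.smul_sum, smul_eq_mul, gridStep, div_pow]
  field_simp


/-- LEMMA B in quadratic-form dress: for real `g₁₁, g₁₂, g₂₂` with the two binary forms
`G = [[g₁₁,g₁₂],[g₁₂,g₂₂]]` and `diag(1-κ,κ) - G` positive semidefinite (stated on real test
vectors), `(ε+α)g₁₁ + 2(ε+ν)g₁₂ + (ε+α+U/2)g₂₂ ≥ -s̃(ε; κ, α, ν, U)`. Pure 2×2 algebra. [folklore] -/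
def RankTwoFloorQF : Prop :=
  ∀ (ε U κ α ν g₁₁ g₁₂ g₂₂ : ℝ),
    (∀ c₁ c₂ : ℝ, 0 ≤ g₁₁ * (c₁ * c₁) + 2 * g₁₂ * (c₁ * c₂) + g₂₂ * (c₂ * c₂)) →
    (∀ c₁ c₂ : ℝ, 0 ≤ (1 - κ - g₁₁) * (c₁ * c₁) - 2 * g₁₂ * (c₁ * c₂) + (κ - g₂₂) * (c₂ * c₂)) →
    -blockFloor ε U κ α ν ≤ (ε + α) * g₁₁ + 2 * (ε + ν) * g₁₂ + (ε + α + U / 2) * g₂₂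

/-! ### LEMMA B — proof (elementary real algebra). -/

/-- Trace pairing of a PSD binary form given by numbers `p, r, s` (`0 ≤ p`, `0 ≤ s`, `r² ≤ ps`)
with a binary form given by its nonnegative quadratic form is nonnegative. [folklore] -/
theorem qf_trace_nonneg {x y z p r s : ℝ}
    (hG : ∀ c₁ c₂ : ℝ, 0 ≤ x * (c₁ * c₁) + 2 * y * (c₁ * c₂) + z * (c₂ * c₂))
    (hp : 0 ≤ p) (hs : 0 ≤ s) (hdet : r * r ≤ p * s) : 0 ≤ p * x + 2 * r * y + s * z := by
  have hz : 0 ≤ z := by have h := hG 0 1; linarith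
  rcases hp.lt_or_eq with hp' | hp'
  · have h1 := hG p r
    have h2 : 0 ≤ z * (p * s - r * r) := mul_nonneg hz (sub_nonneg.mpr hdet)
    have h3 : 0 ≤ p * (p * x + 2 * r * y + s * z) := by nlinarith [h1, h2]
    exact (mul_nonneg_iff_of_pos_left hp').mp h3
  · have hr : r = 0 := by
      have h0 : r * r ≤ 0 := by rw [← hp', zero_mul] at hdet; exact hdet
      exact mul_self_eq_zero.mp (le_antisymm h0 (mul_self_nonneg r))
    rw [← hp', hr]
    nlinarith [hz, hs]

/-- Final bookkeeping: `P t₊ + M t₋ ≥ min(P,0) + min(M,0)` for `t± ∈ [0,1]`. [folklore] -/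
theorem neg_max_sum_le {P M v tp tm : ℝ} (h0p : 0 ≤ tp) (h1p : tp ≤ 1) (h0m : 0 ≤ tm)
    (h1m : tm ≤ 1) (hv : P * tp + M * tm ≤ v) : -(max (-P) 0 + max (-M) 0) ≤ v := by
  have hP : -max (-P) 0 ≤ P * tp := by
    rcases le_or_gt 0 P with h | h
    · rw [max_eq_right (by linarith)]; nlinarith
    · rw [max_eq_left (by linarith)]; nlinarith
  have hM : -max (-M) 0 ≤ M * tm := by
    rcases le_or_gt 0 M with h | h
    · rw [max_eq_right (by linarith)]; nlinarith
    · rw [max_eq_left (by linarith)]; nlinarith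
  linarith

/-- In a nonnegative binary form with vanishing `c₂²`-coefficient the mixed coefficient vanishes. [folklore] -/
theorem qf_offdiag_eq_zero {x y : ℝ}
    (hG : ∀ c₁ c₂ : ℝ, 0 ≤ x * (c₁ * c₁) + 2 * y * (c₁ * c₂) + 0 * (c₂ * c₂)) : y = 0 := by
  by_contra hy
  have hy' : (2 : ℝ) * y ≠ 0 := mul_ne_zero two_ne_zero hy
  have h := hG 1 (-(x + 1) / (2 * y))
  have e : 2 * y * (1 * (-(x + 1) / (2 * y))) = -(x + 1) := by
    rw [one_mul, mul_div_assoc', mul_div_cancel_left₀ _ hy']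
  rw [e, zero_mul] at h
  linarith

/-- The generic case of LEMMA B: `0 < k₁, k₂`, distinct eigenvalues (`0 < D`, `D² = radicand`). [folklore] -/
theorem lemB_generic (a b dd k₁ k₂ D g₁₁ g₁₂ g₂₂ : ℝ) (hk1 : 0 < k₁) (hk2 : 0 < k₂) (hD : 0 < D)
    (hDD : D * D = (k₁ * a - k₂ * dd) ^ 2 / 4 + k₁ * k₂ * b ^ 2)
    (H1 : ∀ c₁ c₂ : ℝ, 0 ≤ g₁₁ * (c₁ * c₁) + 2 * g₁₂ * (c₁ * c₂) + g₂₂ * (c₂ * c₂))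
    (H2 : ∀ c₁ c₂ : ℝ, 0 ≤ (k₁ - g₁₁) * (c₁ * c₁) - 2 * g₁₂ * (c₁ * c₂) + (k₂ - g₂₂) * (c₂ * c₂)) :
    -(max (-((k₁ * a + k₂ * dd) / 2 + D)) 0 + max (-((k₁ * a + k₂ * dd) / 2 - D)) 0)
      ≤ a * g₁₁ + 2 * b * g₁₂ + dd * g₂₂ := by
  -- `D` dominates the half-difference of the diagonal of `N`
  have hDge : |(k₁ * a - k₂ * dd) / 2| ≤ D := by
    rw [← Real.sqrt_sq_eq_abs, show D = Real.sqrt (D * D) from (Real.sqrt_mul_self hD.le).symm]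
    apply Real.sqrt_le_sqrt
    rw [hDD]
    nlinarith [mul_nonneg (mul_nonneg hk1.le hk2.le) (sq_nonneg b)]
  have hD1 : (k₁ * a - k₂ * dd) / 2 ≤ D := le_trans (le_abs_self _) hDge
  have hD2 : -((k₁ * a - k₂ * dd) / 2) ≤ D := le_trans (neg_le_abs _) hDge
  have hDne : D ≠ 0 := ne_of_gt hD
  have hk1ne : k₁ ≠ 0 := ne_of_gt hk1
  have hk2ne : k₂ ≠ 0 := ne_of_gt hk2
  have hd0 : (2 : ℝ) * D ≠ 0 := by positivity
  have hd1 : (2 : ℝ) * D * k₁ ≠ 0 := by positivity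
  have hd2 : (2 : ℝ) * D * k₂ ≠ 0 := by positivity
  -- the spectral projections of `N` pulled back to `G`-space: `Q₋ = K^{-1/2} P₋ K^{-1/2}`, `Q₊ = K⁻¹ - Q₋`
  obtain ⟨P, hP⟩ : ∃ q : ℝ, q = (k₁ * a + k₂ * dd) / 2 + D := ⟨_, rfl⟩
  obtain ⟨M, hM⟩ : ∃ q : ℝ, q = (k₁ * a + k₂ * dd) / 2 - D := ⟨_, rfl⟩
  obtain ⟨qm11, hqm11⟩ : ∃ q : ℝ, q = (P - k₁ * a) / (2 * D * k₁) := ⟨_, rfl⟩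
  obtain ⟨qm12, hqm12⟩ : ∃ q : ℝ, q = -b / (2 * D) := ⟨_, rfl⟩
  obtain ⟨qm22, hqm22⟩ : ∃ q : ℝ, q = (P - k₂ * dd) / (2 * D * k₂) := ⟨_, rfl⟩
  obtain ⟨qp11, hqp11⟩ : ∃ q : ℝ, q = (k₁ * a - M) / (2 * D * k₁) := ⟨_, rfl⟩
  obtain ⟨qp12, hqp12⟩ : ∃ q : ℝ, q = b / (2 * D) := ⟨_, rfl⟩
  obtain ⟨qp22, hqp22⟩ : ∃ q : ℝ, q = (k₂ * dd - M) / (2 * D * k₂) := ⟨_, rfl⟩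
  have keyP : (P - k₁ * a) * (P - k₂ * dd) = k₁ * k₂ * b ^ 2 := by
    rw [hP]; linear_combination hDD
  have keyM : (k₁ * a - M) * (k₂ * dd - M) = k₁ * k₂ * b ^ 2 := by
    rw [hM]; linear_combination hDD
  have hqm11_0 : 0 ≤ qm11 := by
    rw [hqm11]; exact div_nonneg (by rw [hP]; linarith) (by positivity)
  have hqm22_0 : 0 ≤ qm22 := by
    rw [hqm22]; exact div_nonneg (by rw [hP]; linarith) (by positivity)
  have hqp11_0 : 0 ≤ qp11 := by
    rw [hqp11]; exact div_nonneg (by rw [hM]; linarith) (by positivity)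
  have hqp22_0 : 0 ≤ qp22 := by
    rw [hqp22]; exact div_nonneg (by rw [hM]; linarith) (by positivity)
  have hdetm : qm12 * qm12 ≤ qm11 * qm22 := by
    apply le_of_eq
    rw [hqm11, hqm12, hqm22, div_mul_div_comm, div_mul_div_comm, keyP,
      div_eq_div_iff (mul_ne_zero hd0 hd0) (mul_ne_zero hd1 hd2)]
    ring
  have hdetp : qp12 * qp12 ≤ qp11 * qp22 := by
    apply le_of_eq
    rw [hqp11, hqp12, hqp22, div_mul_div_comm, div_mul_div_comm, keyM,
      div_eq_div_iff (mul_ne_zero hd0 hd0) (mul_ne_zero hd1 hd2)]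
    ring
  -- the complementary form `K - G`
  have H2' : ∀ c₁ c₂ : ℝ, 0 ≤ (k₁ - g₁₁) * (c₁ * c₁) + 2 * (-g₁₂) * (c₁ * c₂)
      + (k₂ - g₂₂) * (c₂ * c₂) := by
    intro c₁ c₂; have h := H2 c₁ c₂; linarith
  -- traces against `G` and `K - G`
  obtain ⟨tm, htm⟩ : ∃ q : ℝ, q = qm11 * g₁₁ + 2 * qm12 * g₁₂ + qm22 * g₂₂ := ⟨_, rfl⟩
  obtain ⟨tp, htp⟩ : ∃ q : ℝ, q = qp11 * g₁₁ + 2 * qp12 * g₁₂ + qp22 * g₂₂ := ⟨_, rfl⟩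
  have htm0 : 0 ≤ tm := by rw [htm]; exact qf_trace_nonneg H1 hqm11_0 hqm22_0 hdetm
  have htp0 : 0 ≤ tp := by rw [htp]; exact qf_trace_nonneg H1 hqp11_0 hqp22_0 hdetp
  have htm1' : 0 ≤ qm11 * (k₁ - g₁₁) + 2 * qm12 * (-g₁₂) + qm22 * (k₂ - g₂₂) :=
    qf_trace_nonneg H2' hqm11_0 hqm22_0 hdetm
  have htp1' : 0 ≤ qp11 * (k₁ - g₁₁) + 2 * qp12 * (-g₁₂) + qp22 * (k₂ - g₂₂) :=
    qf_trace_nonneg H2' hqp11_0 hqp22_0 hdetp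
  have htrKm : qm11 * k₁ + qm22 * k₂ = 1 := by
    rw [hqm11, hqm22, div_mul_eq_mul_div, div_mul_eq_mul_div, div_add_div _ _ hd1 hd2,
      div_eq_one_iff_eq (mul_ne_zero hd1 hd2), hP]
    ring
  have htrKp : qp11 * k₁ + qp22 * k₂ = 1 := by
    rw [hqp11, hqp22, div_mul_eq_mul_div, div_mul_eq_mul_div, div_add_div _ _ hd1 hd2,
      div_eq_one_iff_eq (mul_ne_zero hd1 hd2), hM]
    ring
  have htm1 : tm ≤ 1 := by rw [htm]; linarith
  have htp1 : tp ≤ 1 := by rw [htp]; linarith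
  -- `C = P Q₊ + M Q₋`, coefficientwise
  have c11 : P * qp11 + M * qm11 = a := by
    rw [hqp11, hqm11, mul_div_assoc', mul_div_assoc', ← add_div, div_eq_iff hd1, hP, hM]
    ring
  have c12 : P * qp12 + M * qm12 = b := by
    rw [hqp12, hqm12, mul_div_assoc', mul_div_assoc', ← add_div, div_eq_iff hd0, hP, hM]
    ring
  have c22 : P * qp22 + M * qm22 = dd := by
    rw [hqp22, hqm22, mul_div_assoc', mul_div_assoc', ← add_div, div_eq_iff hd2, hP, hM]
    ring
  have hident : a * g₁₁ + 2 * b * g₁₂ + dd * g₂₂ = P * tp + M * tm := by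
    rw [htp, htm, ← c11, ← c12, ← c22]; ring
  rw [← hP, ← hM]
  exact neg_max_sum_le htp0 htp1 htm0 htm1 (le_of_eq hident.symm)

set_option maxHeartbeats 800000 in
/-- **LEMMA B (the `2 × 2` quadratic-form floor), proved**: for `0 ≤ κ ≤ 1` and `0 ⪯ G ⪯ diag(1−κ, κ)`, `tr(C G) ≥ −s̃`. Elementary real algebra: the two spectral projections of the block `K^{1/2} C K^{1/2}` pulled back to `G`-space are PSD with vanishing determinant, their pairings with `G` and `K − G` are nonnegative, so `tr(CG) = λ₊ t₊ + λ₋ t₋` with `t± ∈ [0, 1]`. [folklore] -/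
theorem rankTwoFloorQF_holds : RankTwoFloorQF := by
  intro ε U κ α ν g₁₁ g₁₂ g₂₂ H1 H2
  dsimp only [blockFloor]
  have hg11 : 0 ≤ g₁₁ := by have h := H1 1 0; linarith
  have hg22 : 0 ≤ g₂₂ := by have h := H1 0 1; linarith
  have hg11' : g₁₁ ≤ 1 - κ := by have h := H2 1 0; linarith
  have hg22' : g₂₂ ≤ κ := by have h := H2 0 1; linarith
  have hk1 : 0 ≤ 1 - κ := le_trans hg11 hg11'
  have hk2 : 0 ≤ κ := le_trans hg22 hg22'
  -- degenerate case κ = 0: `G = diag(g₁₁, 0)`, `N = diag(a, 0)`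
  rcases eq_or_lt_of_le hk2 with hκ0 | hκpos
  · subst hκ0
    have hg22z : g₂₂ = 0 := le_antisymm hg22' hg22
    subst hg22z
    have hg12z : g₁₂ = 0 := qf_offdiag_eq_zero H1
    subst hg12z
    have hsq : Real.sqrt (((1 - 0) * (ε + α) - 0 * (ε + α + U / 2)) ^ 2 / 4
        + (1 - 0) * 0 * (ε + ν) ^ 2) = |ε + α| / 2 := by
      rw [show ((1 - 0) * (ε + α) - 0 * (ε + α + U / 2)) ^ 2 / 4 + (1 - 0) * 0 * (ε + ν) ^ 2
          = ((ε + α) / 2) ^ 2 by ring, Real.sqrt_sq_eq_abs, abs_div, abs_two]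
    rw [hsq]
    rcases le_or_gt 0 (ε + α) with ha | ha
    · refine neg_max_sum_le (tp := g₁₁) (tm := 0) hg11 (by linarith) le_rfl zero_le_one ?_
      rw [abs_of_nonneg ha]; linarith
    · refine neg_max_sum_le (tp := 0) (tm := g₁₁) le_rfl zero_le_one hg11 (by linarith) ?_
      rw [abs_of_neg ha]; linarith
  -- degenerate case κ = 1: `G = diag(0, g₂₂)`, `N = diag(0, dd)`
  rcases eq_or_lt_of_le hk1 with hκ1 | hk1pos
  · have hκ : κ = 1 := by linarith
    subst hκ
    have hg11z : g₁₁ = 0 := le_antisymm (by linarith) hg11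
    subst hg11z
    have H1' : ∀ c₁ c₂ : ℝ, 0 ≤ g₂₂ * (c₁ * c₁) + 2 * g₁₂ * (c₁ * c₂) + 0 * (c₂ * c₂) := by
      intro c₁ c₂; have h := H1 c₂ c₁; linarith
    have hg12z : g₁₂ = 0 := qf_offdiag_eq_zero H1'
    subst hg12z
    have hsq : Real.sqrt (((1 - 1) * (ε + α) - 1 * (ε + α + U / 2)) ^ 2 / 4
        + (1 - 1) * 1 * (ε + ν) ^ 2) = |ε + α + U / 2| / 2 := by
      rw [show ((1 - 1) * (ε + α) - 1 * (ε + α + U / 2)) ^ 2 / 4 + (1 - 1) * 1 * (ε + ν) ^ 2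
          = ((ε + α + U / 2) / 2) ^ 2 by ring, Real.sqrt_sq_eq_abs, abs_div, abs_two]
    rw [hsq]
    rcases le_or_gt 0 (ε + α + U / 2) with ha | ha
    · refine neg_max_sum_le (tp := g₂₂) (tm := 0) hg22 (by linarith) le_rfl zero_le_one ?_
      rw [abs_of_nonneg ha]; linarith
    · refine neg_max_sum_le (tp := 0) (tm := g₂₂) le_rfl zero_le_one hg22 (by linarith) ?_
      rw [abs_of_neg ha]; linarith
  -- 0 < κ < 1
  have hs0 : 0 ≤ ((1 - κ) * (ε + α) - κ * (ε + α + U / 2)) ^ 2 / 4 + (1 - κ) * κ * (ε + ν) ^ 2 :=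
    add_nonneg (div_nonneg (sq_nonneg _) (by norm_num))
      (mul_nonneg (mul_nonneg hk1 hk2) (sq_nonneg _))
  have hD0 := Real.sqrt_nonneg (((1 - κ) * (ε + α) - κ * (ε + α + U / 2)) ^ 2 / 4
    + (1 - κ) * κ * (ε + ν) ^ 2)
  have hDD := Real.mul_self_sqrt hs0
  generalize Real.sqrt (((1 - κ) * (ε + α) - κ * (ε + α + U / 2)) ^ 2 / 4
    + (1 - κ) * κ * (ε + ν) ^ 2) = D at hD0 hDD ⊢
  rcases eq_or_lt_of_le hD0 with hDz | hDpos
  · -- equal eigenvalues: `N` is scalar, `b = 0`, `(1-κ) a = κ dd = half`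
    subst hDz
    have hs00 : ((1 - κ) * (ε + α) - κ * (ε + α + U / 2)) ^ 2 / 4
        + (1 - κ) * κ * (ε + ν) ^ 2 = 0 := by rw [← hDD, mul_zero]
    have hsplit := (add_eq_zero_iff_of_nonneg (div_nonneg (sq_nonneg _) (by norm_num))
      (mul_nonneg (mul_nonneg hk1 hk2) (sq_nonneg _))).mp hs00
    have hb0 : ε + ν = 0 := by
      have hkk : (1 - κ) * κ ≠ 0 := ne_of_gt (mul_pos hk1pos hκpos)
      have h2 : (ε + ν) ^ 2 = 0 := by
        rcases mul_eq_zero.mp hsplit.2 with h' | h'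
        · exact absurd h' hkk
        · exact h'
      exact pow_eq_zero_iff (n := 2) (by norm_num) |>.mp h2
    have hdiag : (1 - κ) * (ε + α) - κ * (ε + α + U / 2) = 0 := by
      have h2 : ((1 - κ) * (ε + α) - κ * (ε + α + U / 2)) ^ 2 = 0 := by
        linarith [hsplit.1, sq_nonneg ((1 - κ) * (ε + α) - κ * (ε + α + U / 2))]
      exact pow_eq_zero_iff (n := 2) (by norm_num) |>.mp h2
    have hk1ne : (1 - κ) ≠ 0 := ne_of_gt hk1pos
    have hκne : κ ≠ 0 := ne_of_gt hκpos
    refine neg_max_sum_le (tp := g₁₁ / (1 - κ)) (tm := g₂₂ / κ) (div_nonneg hg11 hk1)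
      (by rw [div_le_one hk1pos]; exact hg11') (div_nonneg hg22 hk2)
      (by rw [div_le_one hκpos]; exact hg22') ?_
    have e1 : (((1 - κ) * (ε + α) + κ * (ε + α + U / 2)) / 2 + 0) * (g₁₁ / (1 - κ))
        = (ε + α) * g₁₁ := by
      rw [show ((1 - κ) * (ε + α) + κ * (ε + α + U / 2)) / 2 + 0 = (1 - κ) * (ε + α) by
        linarith, mul_comm (1 - κ) (ε + α), mul_assoc, mul_div_assoc', mul_div_cancel_left₀ _ hk1ne]
    have e2 : (((1 - κ) * (ε + α) + κ * (ε + α + U / 2)) / 2 - 0) * (g₂₂ / κ)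
        = (ε + α + U / 2) * g₂₂ := by
      rw [show ((1 - κ) * (ε + α) + κ * (ε + α + U / 2)) / 2 - 0 = κ * (ε + α + U / 2) by
        linarith, mul_comm κ (ε + α + U / 2), mul_assoc, mul_div_assoc', mul_div_cancel_left₀ _ hκne]
    rw [e1, e2, hb0]
    linarith
  · exact lemB_generic (ε + α) (ε + ν) (ε + α + U / 2) (1 - κ) κ D g₁₁ g₁₂ g₂₂ hk1pos hκpos
      hDpos hDD H1 H2


end PauliDoublon

end Summit.Ventures.CertifiedManyBodySolver.Lower
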